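import Summits.QuantumFields.YangMills.Theorems.AllWindowsColdBoxBoxHighLineBoxToChartReductionWindowSup
import Summits.QuantumFields.YangMills.Theorems.AllWindowsColdBoxBoxHighLineBoxToChartRelative

/-!
# Steps A+B+C at the U5 window in RELATIVE form — the `ε₁ = 1/8` half of ✓`landauRelativeComparisonBulk_of_split` for EVERY `θ < 1/10`
# (modulo T-S5.6′ `SmallFieldInsideFPSharp`, taken as a hypothesis with its typed body)

Width seat `ym-line-sfw-p2-w2` (prover-ym-line-sfw-p2-w2-g32-0); w2 g31's ✓`BoxToChart.boxPlaqCov_sub_chartCov_relative` (LINE-19 S5, window `12θ < 1`,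
`ε₁ < 1/2 − 4θ`, `ε₁ < 1/2 − 6θ + 2κ₃`) re-run at the U5 window for planner ym-idea-2 g18's next rung (LINE-20 ⟨stmt-QuantumFields-24336⟩,
`stub_landauThirdOrder`, `θ ≤ θL < 1/10`; U5 prep, helper — U5 is UNSTAFFED, I23 open):

* Step A by ✓`BoxToChart.boxPlaqCov_sub_chartCov_le_window_sup 4` (U2 `LandauRepresentativeBound` + T-S5.4J∞ `orbitNormaliserJacobian_sup`):
  window `C·H⁸(1+log β)⁵ ≤ β`, precision `β^{−4}`, `r = K·H·(1+log H)·spl + 2H²(1+log β)²/√β`, premise `spl·H³(1+log H) ≤ c₀`;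
* the small-field tail by the TYPED T-S5.6′ `SmallFieldInsideFPSharp` of `Cruxes/BoxWindowHighSU2213/TaskU5L5.lean` (exponent `C·r·H⁴(1+log H) − cβs²`;
  owner w4 g29), here a HYPOTHESIS `h6` with the Prop's body inlined (so `… smallFieldInsideFPSharp` discharges it definitionally when it lands);
* rarity ✓`exists_forall_boxState_not_smallPlaquettes_le` (`ε₁ > 2θ`) and the floor ✓`boxDirCircSqCov_floor_H`, error arithmetic by ✓`ErrorBudget.*`.

★★★ **`BoxToChart.boxPlaqCov_sub_chartCov_relative_sup`** — for `0 < θ`, `θ/2 < κ₃ < ε₁`, `2θ < ε₁`, **`ε₁ < 1/2 − 3θ`** (U2; was `1/2 − 4θ`) and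
**`5θ + ε₁ − 1/2 < 2κ₃`** (T-S5.6′; was `6θ + ε₁ − 1/2 < 2κ₃`):
`∃ K M L β₀, ∀ β ≥ β₀, ∀ T (L ≤ T, M·T ≤ H), |β²·boxPlaqCov β H T − β²·(⟨c₀c_T⟩_D − ⟨c₀⟩_D⟨c_T⟩_D)| ≤ (1/8)·((3/4)·boxDirCircSqCov H T)` with
`H = ⌈β^θ⌉₊`, `s = β^{κ₃−1/2}`, `spl = β^{ε₁−1/2}`, `r = K·H·(1+log H)·spl + 2·(H²(1+log β)²/√β)`.  The set of `(θ, κ₃, ε₁)` is non-empty iff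
`θ < 1/10` (`2θ < ε₁ < 1/2 − 3θ`) — U5's window exactly; the companion (a)/(K2) constraints of Steps D–E are the 13E holder's.

AMENDED 2026-08-30 (w2 g33): (K1) `θ/2 < κ₃` is idle here — ★★★`boxPlaqCov_sub_chartCov_relative_sup_pos` needs only `0 < κ₃`; the original statement is kept
as its corollary.  Everything proved; no definitions; tree only; standard axioms.  HONEST LABEL: bookkeeping (U5 prep, helper) for the future U5 assembly; CONDITIONAL on
T-S5.6′ (hypothesis `h6`); Steps D–E at third order (L2/L3/L4) are not here; S5 is untouched; U5, ⟨24336⟩, ⟨24004⟩ remain OPEN; no stub is closed by name;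
no crux, rung or summit is proved; **the Yang–Mills mass gap is NOT proved by this file; no summit is proved by a line.**
-/

set_option autoImplicit false

noncomputable section

open MeasureTheory Real
open Literature.Probability.LatticeModels (Site)
open Literature.MathematicalPhysics.QuantumLattice (LGConfig fundamentalRep)
open Summit.QuantumFields.YangMills.Theorems.WeakCouplingRates (boxState boxCentre boxPlaqCov boxDirCircSqCov)

namespace Summit.QuantumFields.YangMills.Theorems.AllWindowsColdBoxBoxHighLine

namespace BoxToChart

open ErrorBudget

set_option maxHeartbeats 800000 in
/-- ★★★ **Steps A+B+C at the U5 window, relative form, under `0 < κ₃` only** (conditional on T-S5.6′, hypothesis `h6` = the body of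
`SmallFieldInsideFPSharp`).  Amended 2026-08-30 (w2 g33): the former hypothesis (K1) `θ/2 < κ₃` was IDLE — it fed only `0 < κ₃` and the dummy first exponent
(coefficient `0`) of ✓`ErrorBudget.exists_forall_natPow_exp_sub_le`; the T-S5.6′ exponent at the U5 window has no `β^θ`-type term. -/
theorem boxPlaqCov_sub_chartCov_relative_sup_pos
    (h6 : ∃ C c c₀ : ℝ, 0 < c ∧ 0 < c₀ ∧ ∀ H : ℕ, 1 ≤ H → ∀ β r s : ℝ, 1 ≤ β → 0 < s → 4 * s ≤ r → r * (H : ℝ) ^ 2 ≤ c₀ →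
      C * (1 + Real.log H) ≤ β * s ^ 2 →
      ∫ a in chartDomain H \ smallField H s, fpChartWeight β H r a ≤
        C * (H : ℝ) ^ 4 * Real.exp (C * r * (H : ℝ) ^ 4 * (1 + Real.log H) - c * β * s ^ 2) *
          ∫ a in smallField H (s / 2), fpChartWeight β H r a)
    {θ κ₃ ε₁ : ℝ} (hθ : 0 < θ) (hκ0 : 0 < κ₃) (hε₁l : κ₃ < ε₁) (hε₁θ : 2 * θ < ε₁) (hε₁u : ε₁ < 1 / 2 - 3 * θ)
    (hε₁u' : 5 * θ + ε₁ - 1 / 2 < 2 * κ₃) :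
    ∃ K M L : ℝ, 0 < K ∧ 1 ≤ M ∧ 1 ≤ L ∧ ∃ β₀ : ℝ, 1 ≤ β₀ ∧ ∀ β : ℝ, β₀ ≤ β → ∀ T : ℕ, L ≤ (T : ℝ) → M * (T : ℝ) ≤ (⌈β ^ θ⌉₊ : ℝ) →
      ∀ (H : ℕ) (s spl r : ℝ), H = ⌈β ^ θ⌉₊ → s = β ^ (κ₃ - 1 / 2) → spl = β ^ (ε₁ - 1 / 2) →
        r = K * H * (1 + Real.log H) * spl + 2 * ((H : ℝ) ^ 2 * (1 + Real.log β) ^ 2 / Real.sqrt β) →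
      |β ^ 2 * boxPlaqCov (fundamentalRep (Fin 2)) β H T -
          β ^ 2 * ((∫ a in smallField H s, chartPlaqCost H (boxCentre H) 1 2 a * chartPlaqCost H (boxCentre H + Pi.single 0 (T : ℤ)) 1 2 a *
                fpChartWeight β H r a) / (∫ a in smallField H s, fpChartWeight β H r a) -
            (∫ a in smallField H s, chartPlaqCost H (boxCentre H) 1 2 a * fpChartWeight β H r a) /
                (∫ a in smallField H s, fpChartWeight β H r a) *
              ((∫ a in smallField H s, chartPlaqCost H (boxCentre H + Pi.single 0 (T : ℤ)) 1 2 a * fpChartWeight β H r a) /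
                (∫ a in smallField H s, fpChartWeight β H r a)))| ≤
        1 / 8 * (3 / 4 * boxDirCircSqCov H T) := by
  obtain ⟨K, C₅, c₀₅, hK, hC₅, hc₀₅, hwin⟩ := boxPlaqCov_sub_chartCov_le_window_sup 4
  obtain ⟨C₆, c₆, c₀₆, hc₆, hc₀₆, h6'⟩ := h6
  obtain ⟨M_D, L_D, hM, hL, hfloor⟩ := boxDirCircSqCov_floor_H
  obtain ⟨β₁, hβ₁1, hp⟩ := exists_forall_boxState_not_smallPlaquettes_le hθ hε₁θ
  obtain ⟨C₆p, hC₆p⟩ : ∃ x : ℝ, x = max C₆ 0 := ⟨_, rfl⟩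
  have hC₆p0 : 0 ≤ C₆p := by rw [hC₆p]; exact le_max_right _ _
  have hC₆le : C₆ ≤ C₆p := by rw [hC₆p]; exact le_max_left _ _
  have hθ0 : 0 ≤ θ := hθ.le
  obtain ⟨Q, hQ⟩ : ∃ x : ℝ, x = 200 * 24 * (32 * π ^ 4 / 3) := ⟨_, rfl⟩
  have hQ0 : 0 < Q := by rw [hQ]; positivity
  obtain ⟨Kτ, hKτ⟩ : ∃ x : ℝ, x = 32 * K * (2 + θ) ^ 2 + 128 * (2 + θ) := ⟨_, rfl⟩
  have hKτ0 : 0 ≤ Kτ := by rw [hKτ]; positivity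
  -- the largeness conditions (ErrorBudget instances)
  obtain ⟨b₁, hb₁1, hb₁⟩ := exists_forall_natPow_log_le (k := 8) (γ := 1) hθ0 (by push_cast; linarith) one_pos C₅ 0 5
  obtain ⟨b₃, -, hb₃⟩ := exists_forall_natPow_log_le (k := 3) (γ := 1 / 2 - ε₁) hθ0 (by push_cast; linarith) hc₀₅ 1 1 0
  obtain ⟨b₄, -, hb₄⟩ := exists_forall_natPow_log_le (k := 3) (γ := 1 / 2 - ε₁) hθ0 (by push_cast; linarith) one_pos (C₅ * K) 1 0
  obtain ⟨b₅, -, hb₅⟩ := exists_forall_natPow_log_le (k := 3) (γ := 1 / 2 - ε₁) hθ0 (by push_cast; linarith)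
    (by norm_num : (0 : ℝ) < 1 / 2) (C₅ * K) 1 0
  obtain ⟨b₆, -, hb₆⟩ := exists_forall_natPow_log_le (k := 4) (γ := 1 / 2) hθ0 (by push_cast; linarith)
    (by norm_num : (0 : ℝ) < 1 / 2) (2 * C₅) 0 2
  obtain ⟨b₇, -, hb₇⟩ := exists_forall_log_pow_div_rpow_le (γ := 1 / 2 - κ₃) (by linarith) (by norm_num : (0 : ℝ) < 1 / 100) 1 0
  obtain ⟨b₈, -, hb₈⟩ := exists_forall_log_pow_div_rpow_le (γ := 2 * (ε₁ - κ₃)) (by linarith) one_pos 17 0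
  obtain ⟨b₉, -, hb₉⟩ := exists_forall_log_pow_div_rpow_le (γ := θ + ε₁ - κ₃) (by linarith) (by positivity : (0 : ℝ) < K / 4) 1 0
  obtain ⟨b₁₀, -, hb₁₀⟩ := exists_forall_natPow_log_le (k := 3) (γ := 1 / 2 - ε₁) hθ0 (by push_cast; linarith)
    (by positivity : (0 : ℝ) < c₀₆ / 2) K 1 0
  obtain ⟨b₁₁, -, hb₁₁⟩ := exists_forall_natPow_log_le (k := 4) (γ := 1 / 2) hθ0 (by push_cast; linarith)
    (by positivity : (0 : ℝ) < c₀₆ / 2) 2 0 2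
  obtain ⟨b₁₂, -, hb₁₂⟩ := exists_forall_natPow_log_le (k := 0) (γ := 2 * κ₃) hθ0 (by push_cast; linarith) one_pos C₆ 1 0
  obtain ⟨b₁₃, -, hb₁₃⟩ := exists_forall_log_pow_div_rpow_le (γ := θ) hθ one_pos 32 0
  obtain ⟨b₁₄, -, hb₁₄⟩ := exists_forall_natPow_log_le (k := 8) (γ := 2) hθ0 (by push_cast; linarith) one_pos Q 0 0
  obtain ⟨b₁₅, -, hb₁₅⟩ := exists_forall_natPow_exp_le (γ := ε₁) hθ0 (by linarith) one_pos one_pos Q 2 8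
  obtain ⟨b₁₆, -, hb₁₆⟩ := exists_forall_natPow_exp_sub_le (γ₁ := κ₃) (γ₁' := 5 * θ + ε₁ - 1 / 2) (γ₂ := 2 * κ₃) hθ0 (by linarith)
    (by linarith) (by linarith) hc₆ one_pos (Q * C₆p) 2 0 (Kτ * C₆p) 12 3
  -- the threshold
  refine ⟨K, 8 * M_D, L_D, hK, by linarith, hL, max (max (max (max 2 β₁) (max b₁ b₃)) (max (max b₄ b₅) (max b₆ b₇)))
    (max (max (max b₈ b₉) (max b₁₀ b₁₁)) (max (max b₁₂ b₁₃) (max (max b₁₄ b₁₅) b₁₆))),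
    le_max_of_le_left (le_max_of_le_left (le_max_of_le_left (le_max_of_le_left (by norm_num)))), ?_⟩
  intro β hβ T hLT hMT H s spl r hHdef hsdef hspldef hrdef
  simp only [max_le_iff] at hβ
  obtain ⟨⟨⟨⟨hβ2, hββ₁⟩, hβb₁, hβb₃⟩, ⟨hβb₄, hβb₅⟩, hβb₆, hβb₇⟩, ⟨⟨hβb₈, hβb₉⟩, hβb₁₀, hβb₁₁⟩, ⟨hβb₁₂, hβb₁₃⟩, ⟨hβb₁₄, hβb₁₅⟩, hβb₁₆⟩ := hβ
  have hβ1 : 1 ≤ β := by linarith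
  have hβ0 : 0 < β := by linarith
  -- `H`
  obtain ⟨hHl, hHu, hH1⟩ := ceil_rpow_bounds (θ := θ) hβ1
  rw [← hHdef] at hHl hHu hH1
  have hH1r : (1 : ℝ) ≤ H := by exact_mod_cast hH1
  have hH0 : (0 : ℝ) < H := by linarith
  have hθpos : 0 < β ^ θ := Real.rpow_pos_of_pos hβ0 θ
  have hlogβ : 0 ≤ Real.log β := Real.log_nonneg hβ1
  have hLβ : 1 ≤ 1 + Real.log β := by linarith
  have hlogH : 0 ≤ 1 + Real.log (H : ℝ) := one_add_log_nonneg hH1r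
  have hlogH1 : 1 ≤ 1 + Real.log (H : ℝ) := by linarith [Real.log_nonneg hH1r]
  have hHk : ∀ k : ℕ, (H : ℝ) ^ k ≤ 2 ^ k * β ^ ((k : ℝ) * θ) := fun k => natCast_pow_le hβ1 hθ0 hHu k
  have hlgH1 : 1 + Real.log (H : ℝ) ≤ (2 + θ) * (1 + Real.log β) := one_add_log_natCast_le hβ1 hθ0 hH1 hHu
  have hlgH : (1 + Real.log (H : ℝ)) ^ 2 ≤ (2 + θ) ^ 2 * (1 + Real.log β) ^ 2 := one_add_log_natCast_pow_le hβ1 hθ0 hH1 hHu 2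
  have hHθk : ∀ k : ℕ, β ^ ((k : ℝ) * θ) ≤ (H : ℝ) ^ k := fun k => by
    rw [mul_comm, Real.rpow_mul hβ0.le, Real.rpow_natCast]
    exact pow_le_pow_left₀ hθpos.le hHl k
  -- `√β = β^{1/2}`
  have hsqrt : Real.sqrt β = β ^ (1 / 2 : ℝ) := Real.sqrt_eq_rpow β
  have hsβ : 0 < Real.sqrt β := Real.sqrt_pos.2 hβ0
  -- `H ≥ 32`
  have hH32 : (32 : ℝ) ≤ H := by
    have h := hb₁₃ β hβb₁₃
    rw [pow_zero, mul_one, div_le_iff₀ hθpos, one_mul] at h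
    exact h.trans hHl
  -- `s`, `spl`
  have hs0 : 0 < s := by rw [hsdef]; exact Real.rpow_pos_of_pos hβ0 _
  have hspl0 : 0 ≤ spl := by rw [hspldef]; exact Real.rpow_nonneg hβ0.le _
  have hs_eq : s = 1 / β ^ (1 / 2 - κ₃) := by
    rw [hsdef, one_div (β ^ (1 / 2 - κ₃)), ← Real.rpow_neg hβ0.le]; ring_nf
  have hspl_eq : spl = 1 / β ^ (1 / 2 - ε₁) := by
    rw [hspldef, one_div (β ^ (1 / 2 - ε₁)), ← Real.rpow_neg hβ0.le]; ring_nf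
  have hs2 : s ^ 2 = β ^ (2 * κ₃ - 1) := by
    rw [hsdef, ← Real.rpow_natCast, ← Real.rpow_mul hβ0.le]; ring_nf
  have hspl2 : spl ^ 2 = β ^ (2 * ε₁ - 1) := by
    rw [hspldef, ← Real.rpow_natCast, ← Real.rpow_mul hβ0.le]; ring_nf
  have hβs2 : β * s ^ 2 = β ^ (2 * κ₃) := by
    rw [hs2, show (2 : ℝ) * κ₃ - 1 = 2 * κ₃ + (-1) by ring, Real.rpow_add hβ0, Real.rpow_neg hβ0.le, Real.rpow_one]
    field_simp
  -- (S1) `s ≤ 1/100`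
  have hs1 : s ≤ 1 / 100 := by
    have h := hb₇ β hβb₇
    rw [pow_zero, mul_one] at h
    rwa [hs_eq]
  -- (S2) `17 s² ≤ spl²`
  have hspls : 17 * s ^ 2 ≤ spl ^ 2 := by
    have h := hb₈ β hβb₈
    rw [pow_zero, mul_one, div_le_iff₀ (Real.rpow_pos_of_pos hβ0 _), one_mul] at h
    rw [hs2, hspl2]
    have e : β ^ (2 * ε₁ - 1) = β ^ (2 * (ε₁ - κ₃)) * β ^ (2 * κ₃ - 1) := by rw [← Real.rpow_add hβ0]; ring_nf
    rw [e]
    exact mul_le_mul_of_nonneg_right h (Real.rpow_nonneg hβ0.le _)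
  -- the two parts of `r`
  have hr₀0 : 0 ≤ K * H * (1 + Real.log H) * spl := by positivity
  have hgap0 : 0 < 2 * ((H : ℝ) ^ 2 * (1 + Real.log β) ^ 2 / Real.sqrt β) := by positivity
  have hr0 : 0 < r := by rw [hrdef]; linarith
  -- the gap part times `H^k` is `2·H^{k+2}·(1+log β)²/β^{1/2}`
  have hgapk : ∀ k : ℕ, 2 * ((H : ℝ) ^ 2 * (1 + Real.log β) ^ 2 / Real.sqrt β) * (H : ℝ) ^ k =
      2 * (H : ℝ) ^ (k + 2) * (1 + Real.log H) ^ 0 * (1 + Real.log β) ^ 2 / β ^ (1 / 2 : ℝ) := by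
    intro k; rw [hsqrt, pow_zero, mul_one, pow_add]; ring
  -- (W4) `spl·H³(1+log H) ≤ c₀₅`
  have hW4 : spl * (H : ℝ) ^ 3 * (1 + Real.log H) ≤ c₀₅ := by
    have h := hb₃ β hβb₃ H hH1 hHu
    rw [pow_one, pow_zero, mul_one, one_mul] at h
    calc spl * (H : ℝ) ^ 3 * (1 + Real.log H) = (H : ℝ) ^ 3 * (1 + Real.log H) / β ^ (1 / 2 - ε₁) := by rw [hspl_eq]; ring
      _ ≤ c₀₅ := h
  -- (W5) `C₅·(K H (1+log H) spl)·H² ≤ 1`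
  have hW5 : C₅ * (K * H * (1 + Real.log H) * spl) * (H : ℝ) ^ 2 ≤ 1 := by
    have h := hb₄ β hβb₄ H hH1 hHu
    rw [pow_one, pow_zero, mul_one] at h
    calc C₅ * (K * H * (1 + Real.log H) * spl) * (H : ℝ) ^ 2 = C₅ * K * (H : ℝ) ^ 3 * (1 + Real.log H) / β ^ (1 / 2 - ε₁) := by
          rw [hspl_eq]; ring
      _ ≤ 1 := h
  -- (W7) `C₅ r H² ≤ 1`
  have hW7 : C₅ * r * (H : ℝ) ^ 2 ≤ 1 := by
    have h1 := hb₅ β hβb₅ H hH1 hHu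
    rw [pow_one, pow_zero, mul_one] at h1
    have h2 := hb₆ β hβb₆ H hH1 hHu
    have h3 : C₅ * (2 * ((H : ℝ) ^ 2 * (1 + Real.log β) ^ 2 / Real.sqrt β)) * (H : ℝ) ^ 2 =
        2 * C₅ * (H : ℝ) ^ 4 * (1 + Real.log H) ^ 0 * (1 + Real.log β) ^ 2 / β ^ (1 / 2 : ℝ) := by
      rw [hsqrt, pow_zero, mul_one]; ring
    calc C₅ * r * (H : ℝ) ^ 2 = C₅ * K * (H : ℝ) ^ 3 * (1 + Real.log H) / β ^ (1 / 2 - ε₁) +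
          C₅ * (2 * ((H : ℝ) ^ 2 * (1 + Real.log β) ^ 2 / Real.sqrt β)) * (H : ℝ) ^ 2 := by rw [hrdef, hspl_eq]; ring
      _ ≤ 1 / 2 + 1 / 2 := add_le_add h1 (by rw [h3]; exact h2)
      _ = 1 := by norm_num
  -- (W1) the T-S5.4J∞ window, (W2) `β^{−4} ≤ 1/2`
  have hW1 : C₅ * (H : ℝ) ^ 8 * (1 + Real.log β) ^ 5 ≤ β := by
    have h := hb₁ β hβb₁ H hH1 hHu
    rw [pow_zero, mul_one, Real.rpow_one, div_le_iff₀ hβ0, one_mul] at h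
    exact h
  have hW2 : (β ^ 4)⁻¹ ≤ 1 / 2 := by
    rw [inv_eq_one_div, div_le_div_iff₀ (by positivity) (by norm_num : (0 : ℝ) < 2)]
    nlinarith [pow_le_pow_left₀ (by norm_num : (0 : ℝ) ≤ 2) hβ2 4]
  -- (T1) `4s ≤ r`, (T2) `r H² ≤ c₀₆`, (T3) `C₆(1+log H) ≤ β s²`
  have hT1 : 4 * s ≤ r := by
    have h := hb₉ β hβb₉
    rw [pow_zero, mul_one, div_le_iff₀ (Real.rpow_pos_of_pos hβ0 _)] at h
    -- `4 β^{κ₃−1/2} ≤ K β^{θ+ε₁−1/2} ≤ K·H·(1+log H)·spl`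
    have hkey : 4 * s ≤ K * (β ^ θ * β ^ (ε₁ - 1 / 2)) := by
      rw [hsdef]
      have e : β ^ θ * β ^ (ε₁ - 1 / 2) = β ^ (θ + ε₁ - κ₃) * β ^ (κ₃ - 1 / 2) := by
        rw [← Real.rpow_add hβ0, ← Real.rpow_add hβ0]; ring_nf
      rw [e, ← mul_assoc]
      have : 4 ≤ K * β ^ (θ + ε₁ - κ₃) := by linarith
      exact mul_le_mul_of_nonneg_right this (Real.rpow_nonneg hβ0.le _)
    have hmono : K * (β ^ θ * β ^ (ε₁ - 1 / 2)) ≤ K * H * (1 + Real.log H) * spl := by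
      rw [hspldef]
      have h1 : β ^ θ * β ^ (ε₁ - 1 / 2) ≤ (H : ℝ) * (1 + Real.log H) * β ^ (ε₁ - 1 / 2) := by
        refine mul_le_mul_of_nonneg_right ?_ (Real.rpow_nonneg hβ0.le _)
        calc β ^ θ ≤ (H : ℝ) := hHl
          _ = (H : ℝ) * 1 := (mul_one _).symm
          _ ≤ (H : ℝ) * (1 + Real.log H) := mul_le_mul_of_nonneg_left hlogH1 hH0.le
      calc K * (β ^ θ * β ^ (ε₁ - 1 / 2)) ≤ K * ((H : ℝ) * (1 + Real.log H) * β ^ (ε₁ - 1 / 2)) := mul_le_mul_of_nonneg_left h1 hK.le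
        _ = K * H * (1 + Real.log H) * β ^ (ε₁ - 1 / 2) := by ring
    calc 4 * s ≤ K * H * (1 + Real.log H) * spl := hkey.trans hmono
      _ ≤ r := by rw [hrdef]; linarith
  have hT2 : r * (H : ℝ) ^ 2 ≤ c₀₆ := by
    have h1 := hb₁₀ β hβb₁₀ H hH1 hHu
    rw [pow_one, pow_zero, mul_one] at h1
    have h2 := hb₁₁ β hβb₁₁ H hH1 hHu
    calc r * (H : ℝ) ^ 2 = K * (H : ℝ) ^ 3 * (1 + Real.log H) / β ^ (1 / 2 - ε₁) +
          2 * ((H : ℝ) ^ 2 * (1 + Real.log β) ^ 2 / Real.sqrt β) * (H : ℝ) ^ 2 := by rw [hrdef, hspl_eq]; ring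
      _ ≤ c₀₆ / 2 + c₀₆ / 2 := add_le_add h1 (by rw [hgapk 2]; exact h2)
      _ = c₀₆ := by ring
  have hT3 : C₆ * (1 + Real.log H) ≤ β * s ^ 2 := by
    have h := hb₁₂ β hβb₁₂ H hH1 hHu
    rw [pow_zero, pow_one, pow_zero, mul_one, mul_one, div_le_iff₀ (Real.rpow_pos_of_pos hβ0 _), one_mul] at h
    rwa [hβs2]
  -- τ
  have hτint := h6' H hH1 β r s hβ1 hs0 hT1 hT2 hT3
  have hrH4 : r * (H : ℝ) ^ 4 * (1 + Real.log H) ≤ Kτ * β ^ (5 * θ + ε₁ - 1 / 2) * (1 + Real.log β) ^ 3 := by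
    -- term 1: `K H⁵ (1+log H)² spl ≤ 32K(2+θ)² β^{5θ+ε₁−1/2} L² ≤ … L³`
    have hL3 : (1 + Real.log β) ^ 2 ≤ (1 + Real.log β) ^ 3 := pow_le_pow_right₀ hLβ (by norm_num)
    have h1 : K * (H : ℝ) ^ 5 * (1 + Real.log H) ^ 2 * spl ≤ 32 * K * (2 + θ) ^ 2 * (β ^ (5 * θ + ε₁ - 1 / 2) * (1 + Real.log β) ^ 3) := by
      have hH5 : (H : ℝ) ^ 5 ≤ 32 * β ^ (5 * θ) := by
        calc (H : ℝ) ^ 5 ≤ 2 ^ 5 * β ^ (((5 : ℕ) : ℝ) * θ) := hHk 5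
          _ = 32 * β ^ (5 * θ) := by norm_num
      have e : β ^ (5 * θ + ε₁ - 1 / 2) = β ^ (5 * θ) * β ^ (ε₁ - 1 / 2) := by rw [← Real.rpow_add hβ0]; ring_nf
      rw [e, hspldef]
      have h2 := mul_le_mul (mul_le_mul hH5 (hlgH.trans (mul_le_mul_of_nonneg_left hL3 (by positivity))) (pow_nonneg hlogH 2) (by positivity))
        le_rfl (Real.rpow_nonneg hβ0.le (ε₁ - 1 / 2)) (by positivity)
      calc K * (H : ℝ) ^ 5 * (1 + Real.log H) ^ 2 * β ^ (ε₁ - 1 / 2) = K * ((H : ℝ) ^ 5 * (1 + Real.log H) ^ 2 * β ^ (ε₁ - 1 / 2)) := by ring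
        _ ≤ K * (32 * β ^ (5 * θ) * ((2 + θ) ^ 2 * (1 + Real.log β) ^ 3) * β ^ (ε₁ - 1 / 2)) := mul_le_mul_of_nonneg_left h2 hK.le
        _ = 32 * K * (2 + θ) ^ 2 * (β ^ (5 * θ) * β ^ (ε₁ - 1 / 2) * (1 + Real.log β) ^ 3) := by ring
    -- term 2: `2 H⁶ (1+log H) L²/√β ≤ 128(2+θ) β^{6θ−1/2} L³ ≤ 128(2+θ) β^{5θ+ε₁−1/2} L³`
    have h2 : 2 * ((H : ℝ) ^ 2 * (1 + Real.log β) ^ 2 / Real.sqrt β) * (H : ℝ) ^ 4 * (1 + Real.log H) ≤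
        128 * (2 + θ) * (β ^ (5 * θ + ε₁ - 1 / 2) * (1 + Real.log β) ^ 3) := by
      have hH6 : (H : ℝ) ^ 6 ≤ 64 * β ^ (6 * θ) := by
        calc (H : ℝ) ^ 6 ≤ 2 ^ 6 * β ^ (((6 : ℕ) : ℝ) * θ) := hHk 6
          _ = 64 * β ^ (6 * θ) := by norm_num
      have hexp6 : β ^ (6 * θ) / Real.sqrt β ≤ β ^ (5 * θ + ε₁ - 1 / 2) := by
        rw [hsqrt, div_le_iff₀ (Real.rpow_pos_of_pos hβ0 _), ← Real.rpow_add hβ0]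
        exact Real.rpow_le_rpow_of_exponent_le hβ1 (by linarith)
      have hnum : 2 * ((H : ℝ) ^ 2 * (1 + Real.log β) ^ 2 / Real.sqrt β) * (H : ℝ) ^ 4 * (1 + Real.log H) =
          2 * ((H : ℝ) ^ 6 * (1 + Real.log H)) * (1 + Real.log β) ^ 2 / Real.sqrt β := by
        field_simp
      rw [hnum, div_le_iff₀ hsβ]
      have h3 : (H : ℝ) ^ 6 * (1 + Real.log H) ≤ 64 * β ^ (6 * θ) * ((2 + θ) * (1 + Real.log β)) :=
        mul_le_mul hH6 hlgH1 hlogH (by positivity)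
      have h4 : 64 * β ^ (6 * θ) ≤ 64 * (β ^ (5 * θ + ε₁ - 1 / 2) * Real.sqrt β) := by
        have := (div_le_iff₀ hsβ).1 hexp6
        linarith
      have h5 : 0 ≤ (2 + θ) * (1 + Real.log β) := by positivity
      calc 2 * ((H : ℝ) ^ 6 * (1 + Real.log H)) * (1 + Real.log β) ^ 2
          ≤ 2 * (64 * β ^ (6 * θ) * ((2 + θ) * (1 + Real.log β))) * (1 + Real.log β) ^ 2 := by gcongr
        _ ≤ 2 * (64 * (β ^ (5 * θ + ε₁ - 1 / 2) * Real.sqrt β) * ((2 + θ) * (1 + Real.log β))) * (1 + Real.log β) ^ 2 := by gcongr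
        _ = 128 * (2 + θ) * (β ^ (5 * θ + ε₁ - 1 / 2) * (1 + Real.log β) ^ 3) * Real.sqrt β := by ring
    calc r * (H : ℝ) ^ 4 * (1 + Real.log H)
        = K * (H : ℝ) ^ 5 * (1 + Real.log H) ^ 2 * spl + 2 * ((H : ℝ) ^ 2 * (1 + Real.log β) ^ 2 / Real.sqrt β) * (H : ℝ) ^ 4 * (1 + Real.log H) := by
          rw [hrdef]; ring
      _ ≤ _ := add_le_add h1 h2
      _ = Kτ * β ^ (5 * θ + ε₁ - 1 / 2) * (1 + Real.log β) ^ 3 := by rw [hKτ]; ring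
  obtain ⟨τ, hτdef⟩ : ∃ x : ℝ, x = C₆p * (H : ℝ) ^ 4 * Real.exp (0 * β ^ κ₃ +
      Kτ * C₆p * β ^ (5 * θ + ε₁ - 1 / 2) * (1 + Real.log β) ^ 3 - c₆ * β ^ (2 * κ₃)) := ⟨_, rfl⟩
  have hτ0 : 0 ≤ τ := by rw [hτdef]; positivity
  have hexp : Real.exp (C₆ * r * (H : ℝ) ^ 4 * (1 + Real.log H) - c₆ * β * s ^ 2) ≤
      Real.exp (0 * β ^ κ₃ + Kτ * C₆p * β ^ (5 * θ + ε₁ - 1 / 2) * (1 + Real.log β) ^ 3 - c₆ * β ^ (2 * κ₃)) := by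
    refine Real.exp_le_exp.2 ?_
    have h0 : 0 ≤ r * (H : ℝ) ^ 4 * (1 + Real.log H) := by positivity
    have h1 : C₆ * r * (H : ℝ) ^ 4 * (1 + Real.log H) ≤ C₆p * (r * (H : ℝ) ^ 4 * (1 + Real.log H)) := by
      rw [show C₆ * r * (H : ℝ) ^ 4 * (1 + Real.log H) = C₆ * (r * (H : ℝ) ^ 4 * (1 + Real.log H)) by ring]
      exact mul_le_mul_of_nonneg_right hC₆le h0
    have h2 : C₆p * (r * (H : ℝ) ^ 4 * (1 + Real.log H)) ≤ C₆p * (Kτ * β ^ (5 * θ + ε₁ - 1 / 2) * (1 + Real.log β) ^ 3) :=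
      mul_le_mul_of_nonneg_left hrH4 hC₆p0
    have h3 : c₆ * β * s ^ 2 = c₆ * β ^ (2 * κ₃) := by rw [mul_assoc, hβs2]
    have h4 : C₆p * (Kτ * β ^ (5 * θ + ε₁ - 1 / 2) * (1 + Real.log β) ^ 3) =
        0 * β ^ κ₃ + Kτ * C₆p * β ^ (5 * θ + ε₁ - 1 / 2) * (1 + Real.log β) ^ 3 := by ring
    linarith
  have hfac : C₆ * (H : ℝ) ^ 4 * Real.exp (C₆ * r * (H : ℝ) ^ 4 * (1 + Real.log H) - c₆ * β * s ^ 2) ≤ τ := by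
    rw [hτdef]
    calc C₆ * (H : ℝ) ^ 4 * Real.exp (C₆ * r * (H : ℝ) ^ 4 * (1 + Real.log H) - c₆ * β * s ^ 2)
        ≤ C₆p * (H : ℝ) ^ 4 * Real.exp (C₆ * r * (H : ℝ) ^ 4 * (1 + Real.log H) - c₆ * β * s ^ 2) :=
          mul_le_mul_of_nonneg_right (mul_le_mul_of_nonneg_right hC₆le (by positivity)) (Real.exp_pos _).le
      _ ≤ C₆p * (H : ℝ) ^ 4 * Real.exp (0 * β ^ κ₃ + Kτ * C₆p * β ^ (5 * θ + ε₁ - 1 / 2) * (1 + Real.log β) ^ 3 - c₆ * β ^ (2 * κ₃)) :=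
          mul_le_mul_of_nonneg_left hexp (by positivity)
  have hI0 : 0 ≤ ∫ a in smallField H (s / 2), fpChartWeight β H r a :=
    setIntegral_nonneg (ChartGauss.measurableSet_smallField _) fun a _ => FPChart.fpChartWeight_nonneg β r a
  have hτ : ∫ a in chartDomain H \ smallField H s, fpChartWeight β H r a ≤ τ * ∫ a in smallField H (s / 2), fpChartWeight β H r a :=
    hτint.trans (mul_le_mul_of_nonneg_right hfac hI0)
  -- Steps A+B+C (absolute)
  have habs := hwin H hH1 β spl r s τ T hβ2 hW1 hW2 hspl0 hW4 hW5 (by rw [hrdef]) hW7 hs0.le hs1 hspls hτ0 hτ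
  -- the floor
  have hMT : M_D * (T : ℝ) ≤ (H : ℝ) / 8 := by
    have : 8 * M_D * (T : ℝ) ≤ H := by rw [hHdef]; exact hMT
    linarith
  have hσ := hfloor H hH32 T hMT hLT
  have hσdef : 3 / (32 * π ^ 4) / (H : ℝ) ^ 8 = 1 / (32 * π ^ 4 / 3 * (H : ℝ) ^ 8) := by field_simp
  -- the three error terms against `σ/24`
  have hE1 : 200 * β ^ 2 * (β ^ 4)⁻¹ ≤ 1 / (32 * π ^ 4 / 3 * (H : ℝ) ^ 8) / 24 := by
    have h := hb₁₄ β hβb₁₄ H hH1 hHu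
    rw [pow_zero, pow_zero, mul_one, mul_one] at h
    rw [le_div_iff₀ (by norm_num : (0 : ℝ) < 24), le_div_iff₀ (by positivity)]
    rw [Real.rpow_two] at h
    have hb : β ^ 2 * (β ^ 4)⁻¹ = (β ^ 2)⁻¹ := by
      rw [show β ^ 4 = β ^ 2 * β ^ 2 by ring, mul_inv, ← mul_assoc, mul_inv_cancel₀ (by positivity), one_mul]
    calc 200 * β ^ 2 * (β ^ 4)⁻¹ * 24 * (32 * π ^ 4 / 3 * (H : ℝ) ^ 8)
        = Q * (H : ℝ) ^ 8 * (β ^ 2 * (β ^ 4)⁻¹) := by rw [hQ]; ring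
      _ = Q * (H : ℝ) ^ 8 / β ^ 2 := by rw [hb, div_eq_mul_inv]
      _ ≤ 1 := h
  have hE2 : 200 * β ^ 2 * ((boxState (fundamentalRep (Fin 2)) β H) {U | ¬ SmallPlaquettes H spl U}).toReal ≤
      1 / (32 * π ^ 4 / 3 * (H : ℝ) ^ 8) / 24 := by
    have h := hb₁₅ β hβb₁₅ H hH1 hHu
    rw [Real.rpow_two, one_mul] at h
    have hpβ := hp β hββ₁
    rw [← hHdef, ← hspldef] at hpβ
    rw [le_div_iff₀ (by norm_num : (0 : ℝ) < 24), le_div_iff₀ (by positivity)]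
    calc 200 * β ^ 2 * ((boxState (fundamentalRep (Fin 2)) β H) {U | ¬ SmallPlaquettes H spl U}).toReal * 24 * (32 * π ^ 4 / 3 * (H : ℝ) ^ 8)
        = Q * (H : ℝ) ^ 8 * β ^ 2 * ((boxState (fundamentalRep (Fin 2)) β H) {U | ¬ SmallPlaquettes H spl U}).toReal := by rw [hQ]; ring
      _ ≤ Q * (H : ℝ) ^ 8 * β ^ 2 * Real.exp (-(β ^ ε₁)) := mul_le_mul_of_nonneg_left hpβ (by positivity)
      _ ≤ 1 := h
  have hE3 : 200 * β ^ 2 * τ ≤ 1 / (32 * π ^ 4 / 3 * (H : ℝ) ^ 8) / 24 := by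
    have h := hb₁₆ β hβb₁₆ H hH1 hHu
    rw [Real.rpow_two] at h
    rw [le_div_iff₀ (by norm_num : (0 : ℝ) < 24), le_div_iff₀ (by positivity)]
    calc 200 * β ^ 2 * τ * 24 * (32 * π ^ 4 / 3 * (H : ℝ) ^ 8)
        = Q * C₆p * (H : ℝ) ^ 12 * β ^ 2 * Real.exp (0 * β ^ κ₃ + Kτ * C₆p * β ^ (5 * θ + ε₁ - 1 / 2) *
            (1 + Real.log β) ^ 3 - c₆ * β ^ (2 * κ₃)) := by rw [hτdef, hQ]; ring
      _ ≤ 1 := h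
  -- conclusion (abstractly, to avoid re-elaborating the chart covariance)
  have key : ∀ X Y : ℝ, |X - Y| ≤ 200 * ((β ^ 4)⁻¹ +
      ((boxState (fundamentalRep (Fin 2)) β H) {U | ¬ SmallPlaquettes H spl U}).toReal + τ) →
      |β ^ 2 * X - β ^ 2 * Y| ≤ 1 / 8 * (3 / 4 * boxDirCircSqCov H T) := by
    intro X Y hXY
    have hβ2sq : 0 ≤ β ^ 2 := sq_nonneg β
    rw [← mul_sub, abs_mul, abs_of_nonneg hβ2sq]
    calc β ^ 2 * |X - Y|
        ≤ β ^ 2 * (200 * ((β ^ 4)⁻¹ + ((boxState (fundamentalRep (Fin 2)) β H) {U | ¬ SmallPlaquettes H spl U}).toReal + τ)) :=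
          mul_le_mul_of_nonneg_left hXY hβ2sq
      _ = 200 * β ^ 2 * (β ^ 4)⁻¹ + 200 * β ^ 2 * ((boxState (fundamentalRep (Fin 2)) β H) {U | ¬ SmallPlaquettes H spl U}).toReal +
            200 * β ^ 2 * τ := by ring
      _ ≤ 1 / (32 * π ^ 4 / 3 * (H : ℝ) ^ 8) / 24 + 1 / (32 * π ^ 4 / 3 * (H : ℝ) ^ 8) / 24 + 1 / (32 * π ^ 4 / 3 * (H : ℝ) ^ 8) / 24 :=
          add_le_add (add_le_add hE1 hE2) hE3
      _ = 1 / 8 * (3 / (32 * π ^ 4) / (H : ℝ) ^ 8) := by rw [hσdef]; ring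
      _ ≤ 1 / 8 * (3 / 4 * boxDirCircSqCov H T) := mul_le_mul_of_nonneg_left hσ (by norm_num)
  exact key _ _ habs

/-- ★★★ **Steps A+B+C at the U5 window, relative form** (conditional on T-S5.6′, hypothesis `h6` = the body of `SmallFieldInsideFPSharp`) — the original
statement with (K1) `θ/2 < κ₃`, now a corollary of `boxPlaqCov_sub_chartCov_relative_sup_pos`. -/
theorem boxPlaqCov_sub_chartCov_relative_sup
    (h6 : ∃ C c c₀ : ℝ, 0 < c ∧ 0 < c₀ ∧ ∀ H : ℕ, 1 ≤ H → ∀ β r s : ℝ, 1 ≤ β → 0 < s → 4 * s ≤ r → r * (H : ℝ) ^ 2 ≤ c₀ →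
      C * (1 + Real.log H) ≤ β * s ^ 2 →
      ∫ a in chartDomain H \ smallField H s, fpChartWeight β H r a ≤
        C * (H : ℝ) ^ 4 * Real.exp (C * r * (H : ℝ) ^ 4 * (1 + Real.log H) - c * β * s ^ 2) *
          ∫ a in smallField H (s / 2), fpChartWeight β H r a)
    {θ κ₃ ε₁ : ℝ} (hθ : 0 < θ) (hκl : θ / 2 < κ₃) (hε₁l : κ₃ < ε₁) (hε₁θ : 2 * θ < ε₁) (hε₁u : ε₁ < 1 / 2 - 3 * θ)
    (hε₁u' : 5 * θ + ε₁ - 1 / 2 < 2 * κ₃) :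
    ∃ K M L : ℝ, 0 < K ∧ 1 ≤ M ∧ 1 ≤ L ∧ ∃ β₀ : ℝ, 1 ≤ β₀ ∧ ∀ β : ℝ, β₀ ≤ β → ∀ T : ℕ, L ≤ (T : ℝ) → M * (T : ℝ) ≤ (⌈β ^ θ⌉₊ : ℝ) →
      ∀ (H : ℕ) (s spl r : ℝ), H = ⌈β ^ θ⌉₊ → s = β ^ (κ₃ - 1 / 2) → spl = β ^ (ε₁ - 1 / 2) →
        r = K * H * (1 + Real.log H) * spl + 2 * ((H : ℝ) ^ 2 * (1 + Real.log β) ^ 2 / Real.sqrt β) →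
      |β ^ 2 * boxPlaqCov (fundamentalRep (Fin 2)) β H T -
          β ^ 2 * ((∫ a in smallField H s, chartPlaqCost H (boxCentre H) 1 2 a * chartPlaqCost H (boxCentre H + Pi.single 0 (T : ℤ)) 1 2 a *
                fpChartWeight β H r a) / (∫ a in smallField H s, fpChartWeight β H r a) -
            (∫ a in smallField H s, chartPlaqCost H (boxCentre H) 1 2 a * fpChartWeight β H r a) /
                (∫ a in smallField H s, fpChartWeight β H r a) *
              ((∫ a in smallField H s, chartPlaqCost H (boxCentre H + Pi.single 0 (T : ℤ)) 1 2 a * fpChartWeight β H r a) /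
                (∫ a in smallField H s, fpChartWeight β H r a)))| ≤
        1 / 8 * (3 / 4 * boxDirCircSqCov H T) :=
  boxPlaqCov_sub_chartCov_relative_sup_pos h6 hθ (lt_trans (half_pos hθ) hκl) hε₁l hε₁θ hε₁u hε₁u'

end BoxToChart

end Summit.QuantumFields.YangMills.Theorems.AllWindowsColdBoxBoxHighLine

end
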